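import Literature.Geometry.GeometricMeasureTheory.CurrentsRepresentable
import Literature.Geometry.GeometricMeasureTheory.FlatComplete
import Mathlib.Analysis.SpecialFunctions.SmoothTransition

/-!
# Slicing of currents by functions: `⟨T, f, r+⟩` and the slicing inequality

Federer 4.2.1: for a current `T ∈ 𝒟_m(U)` with `T` and `∂T` representable by integration (e.g. a
normal current), a Lipschitz `f : U → ℝ` and `r ∈ ℝ`, the **slice**
`⟨T, f, r+⟩ = (∂T) ⌞ {x : f(x) > r} − ∂(T ⌞ {x : f(x) > r}) ∈ 𝒟_{m−1}(U)` satisfies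
`spt ⟨T, f, r+⟩ ⊆ spt T ∩ {f = r}`, `∂⟨T, f, r+⟩ = −⟨∂T, f, r+⟩`,
`𝐌⟨T, f, r+⟩ ≤ Lip(f) lim inf_{h↓0} ‖T‖{r < f < r + h}/h` and
`∫_a^{*b} 𝐌⟨T, f, r+⟩ dr ≤ Lip(f) ‖T‖{a < f < b}`. This file builds the theory for the currents of
`Currents.lean` and smooth `f` (the restriction `T ⌞ A` is that of `CurrentsRepresentable.lean`):

* `TestForm.smulFun`, `Current.smulFun` — **`T ⌞ g`** for a smooth function `g`
  (`(T ⌞ g)(φ) = T(g φ)`); `wedgeOne`, `TestForm.wedgeD`, `Current.wedgeD` — **`dg ∧ φ`** and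
  **`T ⌞ dg`**; the Leibniz rules `d(g φ) = dg ∧ φ + g dφ` (`TestForm.extDerivCLM_smulFun`) and
  **`∂(T ⌞ g) = (∂T) ⌞ g − T ⌞ dg`** (`Current.boundary_smulFun`) [4.1.7].
* `Current.IsRepresentable.tendsto_smulFun_apply` — `(T ⌞ gₙ)(φ) → (T ⌞ A)(φ)` for uniformly
  bounded smooth `gₙ → 1_A` a.e. (dominated convergence in `L¹(‖T‖)`, continuity of `T̄`).
* `Current.IsRepresentable.slice hT hdT hf r` — **`⟨T, f, r+⟩`**; `slice_apply_of_subset_gt/lt`,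
  **`support_slice_subset_inter : spt ⊆ spt T ∩ {f = r}`**, **`boundary_slice : ∂⟨T,f,r+⟩ =
  −⟨∂T,f,r+⟩`**, `support_restrictSet_subset : spt (T ⌞ A) ⊆ spt T`.
* `sliceApprox f r h = S((f − r)/h)` with Mathlib's `Real.smoothTransition` `S`,
  `norm_fderiv_sliceApprox_le`, `tendsto_sliceApprox`; **`tendsto_wedgeD_slice :
  ⟨T, f, r+⟩(φ) = limₙ T(d gₙ ∧ φ)`**.
* **`mass_slice_le_liminf : 𝐌⟨T, f, r+⟩ ≤ liminfₙ C_k (n+1) ∫_{r ≤ f ≤ r+1/(n+1)} ‖Df‖ d‖T‖`**,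
  **`lintegral_mass_slice_le : ∫_{(a,b)} 𝐌⟨T, f, r+⟩ dr ≤ C_k ∫_{f⁻¹[a,b+ε]} ‖Df‖ d‖T‖`** (lower
  integral in `r`; via the measurable majorant `lintegral_liminf_sliceWindow_le`, Fatou and
  Tonelli), and **`ae_mass_slice_lt_top`**: for `‖Df‖` bounded and `𝐌(T) < ∞`, almost every slice
  has finite mass, and `ae_normalMass_slice_lt_top`: almost every slice of a normal current is
  normal. The constant `C_k = (k+1) sup|S'|` (`sliceConst`) replaces Federer's `Lip f`
  (operator norms instead of comass, and a fixed transition profile).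

Not here: Lipschitz (non-smooth) `f`, slices of rectifiable currents as currents of integration
(coarea formula, 4.3.8), iterated slices.

## References

* H. Federer, *Geometric Measure Theory*, Springer 1969, 4.1.7, 4.2.1 [Federer1969].
-/

noncomputable section

open scoped Distributions ENNReal NNReal Topology ContDiff
open MeasureTheory TopologicalSpace Set Filter Metric Function

namespace Literature.Geometry.GeometricMeasureTheory

set_option maxSynthPendingDepth 3



section SmulFun

variable {E : Type*} [NormedAddCommGroup E] [NormedSpace ℝ E] {Ω : Opens E} {m : ℕ}

/-- **Multiplication of test forms by a smooth function** `φ ↦ g φ`, a continuous linear map of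
`𝒟^m(Ω)` (`TestFunction.bilinSmoothCLM` with `B = lsmul`). [cite: Federer1969, 4.1.7] -/
def TestForm.smulFun {g : E → ℝ} (hg : ContDiff ℝ ∞ g) : TestForm Ω m →L[ℝ] TestForm Ω m :=
  TestFunction.bilinSmoothCLM (ContinuousLinearMap.lsmul ℝ ℝ) hg

/-- `(g φ)(x) = g x • φ x`. [folklore] -/
@[simp] theorem TestForm.smulFun_apply {g : E → ℝ} (hg : ContDiff ℝ ∞ g) (φ : TestForm Ω m)
    (x : E) : TestForm.smulFun hg φ x = g x • φ x := rfl

/-- **`T ⌞ g` for a smooth function `g`**: `(T ⌞ g)(φ) = T(g φ)` [Federer1969, 4.1.7: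
"`(T ⌞ ξ)(φ) = T(ξ ∧ φ)`" for a `0`-form `ξ = g`]. [cite: Federer1969, 4.1.7] -/
def Current.smulFun {g : E → ℝ} (hg : ContDiff ℝ ∞ g) (T : Current Ω m) : Current Ω m :=
  T.comp (TestForm.smulFun hg)

/-- Unfolding: `(T ⌞ g)(φ) = T(g φ)`. [cite: Federer1969, 4.1.7] -/
@[simp] theorem Current.smulFun_apply {g : E → ℝ} (hg : ContDiff ℝ ∞ g) (T : Current Ω m)
    (φ : TestForm Ω m) : T.smulFun hg φ = T (TestForm.smulFun hg φ) := rfl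

variable (E m) in
/-- The bilinear map `(ℓ, η) ↦ ℓ ∧ η` from `1`-covectors and `m`-covectors to `(m+1)`-covectors,
realised as `alternatizeUncurryFin (ℓ ⊗ η)` (so that `d(g φ) = dg ∧ φ + g dφ` with Mathlib's
normalisation of `d`). [cite: Federer1969, 4.1.6] -/
def wedgeOne : (E →L[ℝ] ℝ) →L[ℝ] Covector E m →L[ℝ] Covector E (m + 1) :=
  ((ContinuousLinearMap.compL ℝ (Covector E m) (E →L[ℝ] Covector E m) (Covector E (m + 1)))
    (ContinuousAlternatingMap.alternatizeUncurryFinCLM ℝ E ℝ)).comp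
    (ContinuousLinearMap.smulRightL ℝ E (Covector E m))

/-- `ℓ ∧ η = alternatizeUncurryFin (ℓ ⊗ η)`. [folklore] -/
@[simp] theorem wedgeOne_apply (ℓ : E →L[ℝ] ℝ) (η : Covector E m) :
    wedgeOne E m ℓ η = ContinuousAlternatingMap.alternatizeUncurryFin (ℓ.smulRight η) := rfl

/-- `‖ℓ ∧ η‖ ≤ (m + 1) ‖ℓ‖ ‖η‖`. [folklore] -/
theorem norm_wedgeOne_le (ℓ : E →L[ℝ] ℝ) (η : Covector E m) :
    ‖wedgeOne E m ℓ η‖ ≤ (m + 1) * ‖ℓ‖ * ‖η‖ := by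
  rw [wedgeOne_apply, mul_assoc]
  refine (ContinuousAlternatingMap.norm_alternatizeUncurryFin_le _).trans ?_
  rw [ContinuousLinearMap.norm_smulRight_apply]

/-- **The wedge `φ ↦ dg ∧ φ` with the differential of a smooth function**, a continuous linear map
`𝒟^m(Ω) → 𝒟^{m+1}(Ω)`. [cite: Federer1969, 4.1.6] -/
def TestForm.wedgeD {g : E → ℝ} (hg : ContDiff ℝ ∞ g) : TestForm Ω m →L[ℝ] TestForm Ω (m + 1) :=
  TestFunction.bilinSmoothCLM (wedgeOne E m) (contDiff_infty_iff_fderiv.1 hg).2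

/-- `(dg ∧ φ)(x) = alternatizeUncurryFin (Dg(x) ⊗ φ(x))`. [folklore] -/
@[simp] theorem TestForm.wedgeD_apply {g : E → ℝ} (hg : ContDiff ℝ ∞ g) (φ : TestForm Ω m)
    (x : E) : TestForm.wedgeD hg φ x =
      ContinuousAlternatingMap.alternatizeUncurryFin ((fderiv ℝ g x).smulRight (φ x)) := rfl

/-- **Leibniz rule for test forms: `d(g φ) = dg ∧ φ + g dφ`.** [cite: Federer1969, 4.1.6] -/
theorem TestForm.extDerivCLM_smulFun {g : E → ℝ} (hg : ContDiff ℝ ∞ g) (φ : TestForm Ω m) :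
    TestForm.extDerivCLM (TestForm.smulFun hg φ) =
      TestForm.wedgeD hg φ + TestForm.smulFun hg (TestForm.extDerivCLM φ) := by
  apply TestFunction.ext
  intro x
  have h1 := congrFun (TestForm.extDerivCLM_apply (TestForm.smulFun hg φ)) x
  have h2 := congrFun (TestForm.extDerivCLM_apply φ) x
  rw [h1, show (TestForm.wedgeD hg φ + TestForm.smulFun hg (TestForm.extDerivCLM φ)) x =
      TestForm.wedgeD hg φ x + g x • TestForm.extDerivCLM φ x from rfl, h2, TestForm.wedgeD_apply]
  change extDeriv (fun y => g y • φ y) x = _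
  rw [extDeriv, extDeriv, fderiv_fun_smul (hg.differentiable (by simp) x)
    (φ.contDiff.differentiable (by simp) x),
    ContinuousAlternatingMap.alternatizeUncurryFin_add,
    add_comm (ContinuousAlternatingMap.alternatizeUncurryFin (g x • fderiv ℝ (⇑φ) x))]
  congr 1
  exact (ContinuousAlternatingMap.alternatizeUncurryFinCLM ℝ E ℝ).map_smul (g x) (fderiv ℝ (⇑φ) x)

/-- **`T ⌞ dg`**: `(T ⌞ dg)(φ) = T(dg ∧ φ)`, for `T ∈ 𝒟_{m+1}(Ω)`. [cite: Federer1969, 4.1.7] -/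
def Current.wedgeD {g : E → ℝ} (hg : ContDiff ℝ ∞ g) (T : Current Ω (m + 1)) : Current Ω m :=
  T.comp (TestForm.wedgeD hg)

/-- Unfolding: `(T ⌞ dg)(φ) = T(dg ∧ φ)`. [cite: Federer1969, 4.1.7] -/
@[simp] theorem Current.wedgeD_apply {g : E → ℝ} (hg : ContDiff ℝ ∞ g) (T : Current Ω (m + 1))
    (φ : TestForm Ω m) : T.wedgeD hg φ = T (TestForm.wedgeD hg φ) := rfl

/-- **Leibniz rule for currents: `∂(T ⌞ g) = (∂T) ⌞ g − T ⌞ dg`** [Federer1969, 4.1.7: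
"`∂(T ⌞ ξ) = (−1)^k (∂T) ⌞ ξ + … T ⌞ dξ`" for `k = 0`]. [cite: Federer1969, 4.1.7] -/
theorem Current.boundary_smulFun {g : E → ℝ} (hg : ContDiff ℝ ∞ g) (T : Current Ω (m + 1)) :
    (T.smulFun hg).boundary = T.boundary.smulFun hg - T.wedgeD hg := by
  ext φ
  rw [Current.boundary_apply, Current.smulFun_apply,
    show (T.boundary.smulFun hg - T.wedgeD hg) φ = T.boundary.smulFun hg φ - T.wedgeD hg φ from rfl,
    Current.smulFun_apply, Current.boundary_apply, Current.wedgeD_apply,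
    TestForm.extDerivCLM_smulFun, map_add, add_sub_cancel_left]

/-- `spt (g φ) ⊆ spt φ`. [folklore] -/
theorem TestForm.tsupport_smulFun_subset {g : E → ℝ} (hg : ContDiff ℝ ∞ g) (φ : TestForm Ω m) :
    tsupport ⇑(TestForm.smulFun hg φ) ⊆ tsupport ⇑φ :=
  TestFunction.tsupport_bilinSmoothCLM_subset _ hg φ

/-- `spt (dg ∧ φ) ⊆ spt φ`. [folklore] -/
theorem TestForm.tsupport_wedgeD_subset {g : E → ℝ} (hg : ContDiff ℝ ∞ g) (φ : TestForm Ω m) :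
    tsupport ⇑(TestForm.wedgeD hg φ) ⊆ tsupport ⇑φ :=
  TestFunction.tsupport_bilinSmoothCLM_subset _ _ φ

/-- `‖(dg ∧ φ)(x)‖ ≤ (m+1) ‖Dg(x)‖ ‖φ(x)‖`. [folklore] -/
theorem TestForm.norm_wedgeD_apply_le {g : E → ℝ} (hg : ContDiff ℝ ∞ g) (φ : TestForm Ω m)
    (x : E) : ‖TestForm.wedgeD hg φ x‖ ≤ (m + 1) * ‖fderiv ℝ g x‖ * ‖φ x‖ :=
  norm_wedgeOne_le _ _

/-- If `g = 1` near `spt φ`... precisely on an open set containing `spt φ`, then `g φ = φ`.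
[folklore] -/
theorem TestForm.smulFun_eq_self_of_eqOn {g : E → ℝ} (hg : ContDiff ℝ ∞ g) (φ : TestForm Ω m)
    (h : ∀ x ∈ tsupport ⇑φ, g x = 1) : TestForm.smulFun hg φ = φ := by
  apply TestFunction.ext
  intro x
  rw [TestForm.smulFun_apply]
  by_cases hx : x ∈ tsupport ⇑φ
  · rw [h x hx, one_smul]
  · rw [image_eq_zero_of_notMem_tsupport hx, smul_zero]

/-- If `g = 0` on `spt φ` then `g φ = 0`. [folklore] -/
theorem TestForm.smulFun_eq_zero_of_eqOn {g : E → ℝ} (hg : ContDiff ℝ ∞ g) (φ : TestForm Ω m)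
    (h : ∀ x ∈ tsupport ⇑φ, g x = 0) : TestForm.smulFun hg φ = 0 := by
  apply TestFunction.ext
  intro x
  rw [TestForm.smulFun_apply]
  by_cases hx : x ∈ tsupport ⇑φ
  · rw [h x hx, zero_smul]; rfl
  · rw [image_eq_zero_of_notMem_tsupport hx, smul_zero]; rfl

end SmulFun


/-! ### `T ⌞ gₙ → T ⌞ A` under bounded pointwise convergence `gₙ → 1_A` -/

section Approx

variable {E : Type*} [NormedAddCommGroup E] [NormedSpace ℝ E] [FiniteDimensional ℝ E]
  [MeasurableSpace E] [BorelSpace E] {Ω : Opens E} {m : ℕ}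

/-- `(T ⌞ g)(φ) = T̄ [g φ]` for representable `T`. [cite: Federer1969, 4.1.7] -/
theorem Current.IsRepresentable.smulFun_apply_eq_extend {T : Current Ω m} (hT : T.IsRepresentable)
    {g : E → ℝ} (hg : ContDiff ℝ ∞ g) (φ : TestForm Ω m) :
    T.smulFun hg φ = hT.extend (hT.toL1 (TestForm.smulFun hg φ)) := by
  rw [Current.smulFun_apply, hT.extend_toL1]

/-- **`(T ⌞ gₙ)(φ) → (T ⌞ A)(φ)`** when the smooth `gₙ` are uniformly bounded and converge
`‖T‖`-a.e. to `1_A` (dominated convergence in `L¹(‖T‖)` and continuity of `T̄`).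
[cite: Federer1969, 4.1.7] -/
theorem Current.IsRepresentable.tendsto_smulFun_apply {T : Current Ω m} (hT : T.IsRepresentable)
    {g : ℕ → E → ℝ} (hg : ∀ n, ContDiff ℝ ∞ (g n)) {C : ℝ} (hC : ∀ n x, |g n x| ≤ C)
    {A : Set E} (hA : MeasurableSet A)
    (hlim : ∀ᵐ x ∂T.variation, Tendsto (fun n => g n x) atTop (𝓝 (A.indicator 1 x)))
    (φ : TestForm Ω m) :
    Tendsto (fun n => T.smulFun (hg n) φ) atTop (𝓝 (hT.restrictSet A hA φ)) := by
  simp_rw [hT.smulFun_apply_eq_extend, hT.restrictSet_apply]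
  refine (hT.extend.continuous.tendsto _).comp ?_
  rw [tendsto_iff_norm_sub_tendsto_zero]
  have hnorm : ∀ n, ‖hT.toL1 (TestForm.smulFun (hg n) φ) -
      ((hT.integrable_testForm φ).indicator hA).toL1 (A.indicator ⇑φ)‖ =
        (∫⁻ x, ‖g n x • φ x - A.indicator ⇑φ x‖ₑ ∂T.variation).toReal := fun n => by
    rw [hT.toL1_apply, ← Integrable.toL1_sub, Integrable.norm_toL1_eq_lintegral_enorm]; rfl
  simp_rw [hnorm]
  have hC0 : 0 ≤ C := (abs_nonneg _).trans (hC 0 0)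
  have hdct : Tendsto (fun n => ∫⁻ x, ‖g n x • φ x - A.indicator ⇑φ x‖ₑ ∂T.variation) atTop
      (𝓝 (∫⁻ _, (0 : ℝ≥0∞) ∂T.variation)) := by
    refine tendsto_lintegral_of_dominated_convergence' (fun x => ENNReal.ofReal (C + 1) * ‖φ x‖ₑ)
      (fun n => ?_) (fun n => Eventually.of_forall fun x => ?_) ?_ ?_
    · exact ((((hg n).continuous.smul φ.continuous).aestronglyMeasurable).sub
        (φ.continuous.aestronglyMeasurable.indicator hA)).enorm
    · show ‖g n x • φ x - A.indicator ⇑φ x‖ₑ ≤ ENNReal.ofReal (C + 1) * ‖φ x‖ₑ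
      rw [← ofReal_norm, ← ofReal_norm, ← ENNReal.ofReal_mul (by linarith)]
      apply ENNReal.ofReal_le_ofReal
      calc ‖g n x • φ x - A.indicator ⇑φ x‖ ≤ ‖g n x • φ x‖ + ‖A.indicator ⇑φ x‖ :=
            norm_sub_le _ _
        _ ≤ C * ‖φ x‖ + ‖φ x‖ := add_le_add (by
            rw [norm_smul, Real.norm_eq_abs]
            exact mul_le_mul_of_nonneg_right (hC n x) (norm_nonneg _))
            (norm_indicator_le_norm_self _ _)
        _ = (C + 1) * ‖φ x‖ := by ring
    · rw [lintegral_const_mul' _ _ ENNReal.ofReal_ne_top]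
      exact ENNReal.mul_ne_top ENNReal.ofReal_ne_top (hT.lintegral_enorm_ne_top φ)
    · filter_upwards [hlim] with x hx
      have h1 : Tendsto (fun n => g n x • φ x - A.indicator ⇑φ x) atTop (𝓝 0) := by
        have h2 := (hx.smul_const (φ x)).sub_const (A.indicator ⇑φ x)
        have h3 : A.indicator (1 : E → ℝ) x • φ x - A.indicator ⇑φ x = 0 := by
          by_cases hxA : x ∈ A <;> simp [hxA]
        rwa [h3] at h2
      simpa [Function.comp_def] using (continuous_enorm.tendsto (0 : Covector E m)).comp h1
  rw [lintegral_zero] at hdct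
  simpa [Function.comp_def] using (ENNReal.tendsto_toReal ENNReal.zero_ne_top).comp hdct

end Approx

/-! ### The slice `⟨T, f, r+⟩` -/

section Slice

variable {E : Type*} [NormedAddCommGroup E] [NormedSpace ℝ E] [FiniteDimensional ℝ E]
  [MeasurableSpace E] [BorelSpace E] {Ω : Opens E} {k : ℕ}

/-- The superlevel sets of a continuous function are measurable. [folklore] -/
theorem measurableSet_lt_of_continuous {X : Type*} [TopologicalSpace X] [MeasurableSpace X]
    [OpensMeasurableSpace X] {f : X → ℝ} (hf : Continuous f) (r : ℝ) :
    MeasurableSet {x | r < f x} :=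
  (isOpen_lt continuous_const hf).measurableSet

/-- **The slice `⟨T, f, r+⟩ = (∂T) ⌞ {f > r} − ∂(T ⌞ {f > r})`** of a current `T` with `T` and `∂T`
representable by integration (e.g. `T` normal, or an integral flat chain of locally finite mass)
by a continuous function `f` at the level `r` [Federer1969, 4.2.1:
"`⟨T, f, r+⟩ = (∂T) ⌞ {x : f(x) > r} − ∂(T ⌞ {x : f(x) > r})`"]. [cite: Federer1969, 4.2.1] -/
def Current.IsRepresentable.slice {T : Current Ω (k + 1)} (hT : T.IsRepresentable)
    (hdT : T.boundary.IsRepresentable) {f : E → ℝ} (hf : Continuous f) (r : ℝ) : Current Ω k :=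
  hdT.restrictSet {x | r < f x} (measurableSet_lt_of_continuous hf r) -
    (hT.restrictSet {x | r < f x} (measurableSet_lt_of_continuous hf r)).boundary

/-- Unfolding the slice on a test form. [cite: Federer1969, 4.2.1] -/
theorem Current.IsRepresentable.slice_apply {T : Current Ω (k + 1)} (hT : T.IsRepresentable)
    (hdT : T.boundary.IsRepresentable) {f : E → ℝ} (hf : Continuous f) (r : ℝ) (φ : TestForm Ω k) :
    hT.slice hdT hf r φ = hdT.restrictSet {x | r < f x} (measurableSet_lt_of_continuous hf r) φ -
      hT.restrictSet {x | r < f x} (measurableSet_lt_of_continuous hf r)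
        (TestForm.extDerivCLM φ) := rfl

/-- **The slice kills forms supported in `{f > r}`**: there `(∂T) ⌞ U = ∂T` and
`∂(T ⌞ U) = ∂T`. [cite: Federer1969, 4.2.1] -/
theorem Current.IsRepresentable.slice_apply_of_subset_gt {T : Current Ω (k + 1)}
    (hT : T.IsRepresentable) (hdT : T.boundary.IsRepresentable) {f : E → ℝ} (hf : Continuous f)
    {r : ℝ} {φ : TestForm Ω k} (h : tsupport ⇑φ ⊆ {x | r < f x}) : hT.slice hdT hf r φ = 0 := by
  rw [hT.slice_apply,
    hdT.restrictSet_apply_of_support_subset _ ((subset_tsupport _).trans h),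
    hT.restrictSet_apply_of_support_subset _ ((subset_tsupport _).trans
      ((TestForm.tsupport_extDerivCLM_subset φ).trans h)),
    Current.boundary_apply, sub_self]

/-- **The slice kills forms supported in `{f < r}`**: there both restrictions vanish.
[cite: Federer1969, 4.2.1] -/
theorem Current.IsRepresentable.slice_apply_of_subset_lt {T : Current Ω (k + 1)}
    (hT : T.IsRepresentable) (hdT : T.boundary.IsRepresentable) {f : E → ℝ} (hf : Continuous f)
    {r : ℝ} {φ : TestForm Ω k} (h : tsupport ⇑φ ⊆ {x | f x < r}) : hT.slice hdT hf r φ = 0 := by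
  have hd : ∀ {j : ℕ} (ψ : E → Covector E j), Function.support ψ ⊆ tsupport ⇑φ →
      Disjoint (Function.support ψ) {x | r < f x} := fun ψ hψ =>
    Set.disjoint_left.2 fun x hx hx' => (lt_asymm (show f x < r from h (hψ hx))) (show r < f x from hx')
  rw [hT.slice_apply, hdT.restrictSet_apply_of_disjoint _ (hd _ (subset_tsupport _)),
    zero_sub, neg_eq_zero]
  exact hT.restrictSet_apply_of_disjoint _ (hd (⇑(TestForm.extDerivCLM φ))
    ((subset_tsupport _).trans (TestForm.tsupport_extDerivCLM_subset φ)))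

/-- **`spt ⟨T, f, r+⟩ ⊆ {f = r}`.** [cite: Federer1969, 4.2.1] -/
theorem Current.IsRepresentable.support_slice_subset {T : Current Ω (k + 1)}
    (hT : T.IsRepresentable) (hdT : T.boundary.IsRepresentable) {f : E → ℝ} (hf : Continuous f)
    (r : ℝ) : (hT.slice hdT hf r).support ⊆ {x | f x = r} := by
  intro x hx
  by_contra hne
  rcases lt_or_gt_of_ne hne with hlt | hgt
  · obtain ⟨φ, hφ, hφ0⟩ := hx.2 {y | f y < r} ((isOpen_lt hf continuous_const).mem_nhds hlt)
    exact hφ0 (hT.slice_apply_of_subset_lt hdT hf hφ)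
  · obtain ⟨φ, hφ, hφ0⟩ := hx.2 {y | r < f y} ((isOpen_lt continuous_const hf).mem_nhds hgt)
    exact hφ0 (hT.slice_apply_of_subset_gt hdT hf hφ)

/-- The restriction of the zero current is zero. [folklore] -/
theorem Current.IsRepresentable.restrictSet_of_eq_zero {m : ℕ} {T : Current Ω m}
    (hT : T.IsRepresentable) (h0 : T = 0) {A : Set E} (hA : MeasurableSet A) :
    hT.restrictSet A hA = 0 := by
  subst h0
  ext φ
  rw [hT.restrictSet_apply]
  have hext : hT.extend = 0 := (hT.eq_extend 0 fun ψ => rfl).symm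
  rw [hext]; rfl

/-- **`∂⟨T, f, r+⟩ = −⟨∂T, f, r+⟩`.** [cite: Federer1969, 4.2.1] -/
theorem Current.IsRepresentable.boundary_slice {T : Current Ω (k + 2)} (hT : T.IsRepresentable)
    (hdT : T.boundary.IsRepresentable) (hddT : T.boundary.boundary.IsRepresentable)
    {f : E → ℝ} (hf : Continuous f) (r : ℝ) :
    (hT.slice hdT hf r).boundary = -(hdT.slice hddT hf r) := by
  ext φ
  rw [Current.boundary_apply, hT.slice_apply, show (-(hdT.slice hddT hf r)) φ =
      -(hdT.slice hddT hf r φ) from rfl, hdT.slice_apply, TestForm.extDerivCLM_extDerivCLM,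
    map_zero, sub_zero, hddT.restrictSet_of_eq_zero (Current.boundary_boundary T), neg_sub,
    show (0 : Current Ω k) φ = 0 from rfl, sub_zero]

/-- **`spt ⟨T, f, r+⟩ ⊆ spt T`** (indeed `⊆ spt T ∩ {f = r}`): `T ⌞ U` and `(∂T) ⌞ U` are supported
in `spt T`. First the general fact `spt (T ⌞ A) ⊆ spt T`. [cite: Federer1969, 4.1.7] -/
theorem Current.variation_eq_zero_of_disjoint_support {m : ℕ} (T : Current Ω m)
    {W : Set E} (hW : IsOpen W) (hd : Disjoint W T.support) : T.variation W = 0 := by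
  rw [T.variation_apply_of_isOpen hW]
  refine le_antisymm (iSup_le fun φ => iSup_le fun _ => iSup_le fun hφW => ?_) bot_le
  rw [T.apply_eq_zero_of_disjoint_support (hd.mono_left hφW), ENNReal.ofReal_zero]

/-- `spt (T ⌞ A) ⊆ spt T`. [cite: Federer1969, 4.1.7] -/
theorem Current.IsRepresentable.support_restrictSet_subset {m : ℕ} {T : Current Ω m}
    (hT : T.IsRepresentable) {A : Set E} (hA : MeasurableSet A) :
    (hT.restrictSet A hA).support ⊆ T.support := by
  intro x hx
  by_contra hxT
  -- an open neighbourhood of `x` off `spt T`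
  obtain ⟨U, hU, hTU⟩ := T.exists_nhds_of_not_mem_support hx.1 hxT
  obtain ⟨W, hWU, hW, hxW⟩ := _root_.mem_nhds_iff.1 hU
  obtain ⟨φ, hφW, hφ0⟩ := hx.2 W (hW.mem_nhds hxW)
  refine hφ0 ?_
  -- `|(T ⌞ A)(φ)| ≤ ∫_A ‖φ‖ d‖T‖ ≤ sup ‖φ‖ · ‖T‖(W) = 0`
  have hvar : T.variation W = 0 := by
    refine T.variation_eq_zero_of_disjoint_support hW (Set.disjoint_left.2 fun y hy hyT => ?_)
    obtain ⟨ψ, hψ, hψ0⟩ := hyT.2 W (hW.mem_nhds hy)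
    exact hψ0 (hTU ψ (hψ.trans hWU))
  have hb := hT.abs_restrictSet_apply_le A hA φ
  have h0 : ∫⁻ x in A, ‖φ x‖ₑ ∂T.variation = 0 := by
    refine le_antisymm ?_ bot_le
    calc ∫⁻ x in A, ‖φ x‖ₑ ∂T.variation ≤ ∫⁻ x, ‖φ x‖ₑ ∂T.variation :=
          setLIntegral_le_lintegral _ _
      _ = ∫⁻ x in W, ‖φ x‖ₑ ∂T.variation := by
          rw [← lintegral_indicator hW.measurableSet]
          refine lintegral_congr fun y => ?_
          by_cases hy : y ∈ W
          · rw [indicator_of_mem hy]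
          · rw [indicator_of_notMem hy, image_eq_zero_of_notMem_tsupport fun h => hy (hφW h),
              enorm_zero]
      _ ≤ ∫⁻ _ in W, ⊤ ∂T.variation := lintegral_mono fun _ => le_top
      _ = 0 := by rw [setLIntegral_const, hvar, mul_zero]
  rw [h0, ENNReal.toReal_zero] at hb
  exact abs_nonpos_iff.1 hb

/-- **`spt ⟨T, f, r+⟩ ⊆ spt T ∩ {f = r}`.** [cite: Federer1969, 4.2.1] -/
theorem Current.IsRepresentable.support_slice_subset_inter {T : Current Ω (k + 1)}
    (hT : T.IsRepresentable) (hdT : T.boundary.IsRepresentable) {f : E → ℝ} (hf : Continuous f)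
    (r : ℝ) : (hT.slice hdT hf r).support ⊆ T.support ∩ {x | f x = r} := by
  refine subset_inter ?_ (hT.support_slice_subset hdT hf r)
  unfold Current.IsRepresentable.slice
  rw [sub_eq_add_neg]
  refine (Current.support_add_subset _ _).trans (union_subset ?_ ?_)
  · exact (hdT.support_restrictSet_subset _).trans (Current.support_boundary_subset T)
  · rw [Current.support_neg]
    exact (Current.support_boundary_subset _).trans (hT.support_restrictSet_subset _)

end Slice

/-! ### The smooth transition and the approximants `gₕ = S((f − r)/h)` -/

section Transition

open Real in
/-- A bound for the derivative of Mathlib's smooth transition function `S` (`S = 0` on `(-∞, 0]`,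
`S = 1` on `[1, ∞)`): the supremum of `‖S'‖` over `[0, 1]`. [folklore] -/
def smoothTransitionDerivBound : ℝ :=
  sSup ((fun t => ‖fderiv ℝ Real.smoothTransition t‖) '' Icc (0 : ℝ) 1)

/-- `0 ≤ M_S`. [folklore] -/
theorem smoothTransitionDerivBound_nonneg : 0 ≤ smoothTransitionDerivBound := by
  apply Real.sSup_nonneg
  rintro _ ⟨t, -, rfl⟩
  exact norm_nonneg _

/-- The smooth transition is `C^∞`. [folklore] -/
theorem contDiff_smoothTransition : ContDiff ℝ ∞ Real.smoothTransition :=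
  Real.smoothTransition.contDiff (n := ⊤)

/-- `S' = 0` off `[0, 1]` and `‖S'‖ ≤ M_S` on `[0, 1]`:
`‖S'(t)‖ ≤ M_S · 1_{[0,1]}(t)`. [folklore] -/
theorem norm_fderiv_smoothTransition_le (t : ℝ) :
    ‖fderiv ℝ Real.smoothTransition t‖ ≤
      smoothTransitionDerivBound * (Icc (0 : ℝ) 1).indicator 1 t := by
  by_cases ht : t ∈ Icc (0 : ℝ) 1
  · rw [indicator_of_mem ht, Pi.one_apply, mul_one]
    have hc : Continuous fun t => ‖fderiv ℝ Real.smoothTransition t‖ :=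
      (contDiff_smoothTransition.continuous_fderiv (by simp)).norm
    exact le_csSup (isCompact_Icc.bddAbove_image hc.continuousOn) (mem_image_of_mem _ ht)
  · rw [indicator_of_notMem ht, mul_zero]
    rw [mem_Icc, not_and_or, not_le, not_le] at ht
    rcases ht with ht | ht
    · have h : Real.smoothTransition =ᶠ[𝓝 t] fun _ => (0 : ℝ) := by
        filter_upwards [Iio_mem_nhds ht] with s hs
        exact Real.smoothTransition.zero_of_nonpos (le_of_lt hs)
      rw [h.fderiv_eq]; simp
    · have h : Real.smoothTransition =ᶠ[𝓝 t] fun _ => (1 : ℝ) := by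
        filter_upwards [Ioi_mem_nhds ht] with s hs
        exact Real.smoothTransition.one_of_one_le (le_of_lt hs)
      rw [h.fderiv_eq]; simp

section Plain

variable {E : Type*}

/-- The approximant `g_{r,h} = S(h⁻¹ (f − r))` of `1_{f > r}`. [cite: Federer1969, 4.2.1] -/
def sliceApprox (f : E → ℝ) (r h : ℝ) (x : E) : ℝ := Real.smoothTransition (h⁻¹ * (f x - r))

/-- `0 ≤ g_{r,h} ≤ 1`, as `|g| ≤ 1`. [folklore] -/
theorem abs_sliceApprox_le (f : E → ℝ) (r h : ℝ) (x : E) : |sliceApprox f r h x| ≤ 1 := by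
  unfold sliceApprox
  rw [abs_le]
  exact ⟨by linarith [Real.smoothTransition.nonneg (h⁻¹ * (f x - r))],
    Real.smoothTransition.le_one _⟩

/-- `g_{r,h} = 0` where `f ≤ r` (for `h > 0`). [folklore] -/
theorem sliceApprox_eq_zero {f : E → ℝ} {r h : ℝ} (hh : 0 < h) {x : E} (hx : f x ≤ r) :
    sliceApprox f r h x = 0 :=
  Real.smoothTransition.zero_of_nonpos (mul_nonpos_of_nonneg_of_nonpos (inv_nonneg.2 hh.le)
    (by linarith))

/-- `g_{r,h} = 1` where `f ≥ r + h` (for `h > 0`). [folklore] -/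
theorem sliceApprox_eq_one {f : E → ℝ} {r h : ℝ} (hh : 0 < h) {x : E} (hx : r + h ≤ f x) :
    sliceApprox f r h x = 1 :=
  Real.smoothTransition.one_of_one_le (by
    rw [le_inv_mul_iff₀ hh]; linarith)

/-- **`g_{r,1/(n+1)} → 1_{f > r}` pointwise.** [cite: Federer1969, 4.2.1] -/
theorem tendsto_sliceApprox (f : E → ℝ) (r : ℝ) (x : E) :
    Tendsto (fun n : ℕ => sliceApprox f r (1 / ((n : ℝ) + 1)) x) atTop
      (𝓝 ({y | r < f y}.indicator 1 x)) := by
  by_cases hx : r < f x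
  · rw [indicator_of_mem (show x ∈ {y | r < f y} from hx), Pi.one_apply]
    refine tendsto_atTop_of_eventually_const (i₀ := Nat.ceil (1 / (f x - r))) fun n hn => ?_
    apply sliceApprox_eq_one (by positivity)
    have hpos : 0 < f x - r := by linarith
    have h1 : 1 / (f x - r) ≤ n := (Nat.le_ceil _).trans (by exact_mod_cast hn)
    have h2 : 1 / ((n : ℝ) + 1) ≤ f x - r := by
      rw [div_le_iff₀ (by positivity)]
      rw [div_le_iff₀ hpos] at h1
      nlinarith
    linarith
  · rw [indicator_of_notMem (show x ∉ {y | r < f y} from hx)]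
    refine tendsto_const_nhds.congr fun n => ?_
    exact (sliceApprox_eq_zero (by positivity) (not_lt.1 hx)).symm

end Plain

section Smooth

variable {E : Type*} [NormedAddCommGroup E] [NormedSpace ℝ E]

/-- `g_{r,h}` is smooth for smooth `f`. [folklore] -/
theorem contDiff_sliceApprox {f : E → ℝ} (hf : ContDiff ℝ ∞ f) (r h : ℝ) :
    ContDiff ℝ ∞ (sliceApprox f r h) :=
  contDiff_smoothTransition.comp (contDiff_const.mul (hf.sub contDiff_const))

/-- **`‖D g_{r,h}(x)‖ ≤ (M_S / h) ‖Df(x)‖ 1_{r ≤ f ≤ r+h}(x)`.** [cite: Federer1969, 4.2.1] -/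
theorem norm_fderiv_sliceApprox_le {f : E → ℝ} (hf : ContDiff ℝ ∞ f) {r h : ℝ} (hh : 0 < h)
    (x : E) : ‖fderiv ℝ (sliceApprox f r h) x‖ ≤
      smoothTransitionDerivBound / h * ‖fderiv ℝ f x‖ * (f ⁻¹' Icc r (r + h)).indicator 1 x := by
  have hdi : DifferentiableAt ℝ (fun y => h⁻¹ * (f y - r)) x :=
    ((hf.differentiable (by simp) x).sub_const r).const_mul _
  have hcomp : fderiv ℝ (sliceApprox f r h) x =
      (fderiv ℝ Real.smoothTransition (h⁻¹ * (f x - r))).comp (h⁻¹ • fderiv ℝ f x) := by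
    show fderiv ℝ (Real.smoothTransition ∘ fun y => h⁻¹ * (f y - r)) x = _
    rw [fderiv_comp x (contDiff_smoothTransition.differentiable (by simp) _) hdi,
      fderiv_const_mul ((hf.differentiable (by simp) x).sub_const r), fderiv_sub_const]
  rw [hcomp]
  refine (ContinuousLinearMap.opNorm_comp_le _ _).trans ?_
  rw [norm_smul, norm_inv, Real.norm_of_nonneg hh.le]
  have hS := norm_fderiv_smoothTransition_le (h⁻¹ * (f x - r))
  have hind : (Icc (0 : ℝ) 1).indicator (1 : ℝ → ℝ) (h⁻¹ * (f x - r)) =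
      (f ⁻¹' Icc r (r + h)).indicator 1 x := by
    by_cases hx : x ∈ f ⁻¹' Icc r (r + h)
    · have hmem : h⁻¹ * (f x - r) ∈ Icc (0 : ℝ) 1 := by
        obtain ⟨h1, h2⟩ := mem_preimage.1 hx
        exact ⟨mul_nonneg (inv_nonneg.2 hh.le) (sub_nonneg.2 h1),
          by rw [inv_mul_le_iff₀ hh]; linarith⟩
      rw [indicator_of_mem hx, indicator_of_mem hmem]; rfl
    · have hnot : h⁻¹ * (f x - r) ∉ Icc (0 : ℝ) 1 := by
        intro hmem
        apply hx
        obtain ⟨h1, h2⟩ := hmem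
        rw [inv_mul_le_iff₀ hh] at h2
        have h1' : 0 ≤ f x - r := by
          by_contra hneg
          rw [not_le] at hneg
          have : h⁻¹ * (f x - r) < 0 := mul_neg_of_pos_of_neg (inv_pos.2 hh) hneg
          linarith
        exact ⟨by linarith, by linarith⟩
      rw [indicator_of_notMem hx, indicator_of_notMem hnot]
  rw [hind] at hS
  calc ‖fderiv ℝ Real.smoothTransition (h⁻¹ * (f x - r))‖ * (h⁻¹ * ‖fderiv ℝ f x‖)
      ≤ smoothTransitionDerivBound * (f ⁻¹' Icc r (r + h)).indicator 1 x * (h⁻¹ * ‖fderiv ℝ f x‖) :=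
        mul_le_mul_of_nonneg_right hS (by positivity)
    _ = smoothTransitionDerivBound / h * ‖fderiv ℝ f x‖ * (f ⁻¹' Icc r (r + h)).indicator 1 x := by
        rw [div_eq_mul_inv]; ring

end Smooth

end Transition

/-! ### The slice as a limit and its mass -/

section SliceMass

variable {E : Type*} [NormedAddCommGroup E] [NormedSpace ℝ E] [FiniteDimensional ℝ E]
  [MeasurableSpace E] [BorelSpace E] {Ω : Opens E} {k : ℕ}

omit [FiniteDimensional ℝ E] [MeasurableSpace E] [BorelSpace E] in
/-- `T(dg ∧ φ) = ((∂T) ⌞ g)(φ) − (T ⌞ g)(dφ)` (the Leibniz rule read off on a test form).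
[cite: Federer1969, 4.1.7] -/
theorem Current.wedgeD_apply_eq {g : E → ℝ} (hg : ContDiff ℝ ∞ g) (T : Current Ω (k + 1))
    (φ : TestForm Ω k) :
    T.wedgeD hg φ = T.boundary.smulFun hg φ - T.smulFun hg (TestForm.extDerivCLM φ) := by
  have h := congrArg (fun S : Current Ω k => S φ) (T.boundary_smulFun hg)
  change (T.smulFun hg).boundary φ = (T.boundary.smulFun hg - T.wedgeD hg) φ at h
  rw [Current.boundary_apply,
    show (T.boundary.smulFun hg - T.wedgeD hg) φ = T.boundary.smulFun hg φ - T.wedgeD hg φ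
      from rfl] at h
  simp only [Current.smulFun_apply] at h ⊢
  linarith

/-- **The slice is the limit of `T(d gₙ ∧ φ)`** along the approximants `gₙ = S((n+1)(f − r))`
of `1_{f > r}`: `⟨T, f, r+⟩(φ) = limₙ T(d gₙ ∧ φ)`. [cite: Federer1969, 4.2.1] -/
theorem Current.IsRepresentable.tendsto_wedgeD_slice {T : Current Ω (k + 1)}
    (hT : T.IsRepresentable) (hdT : T.boundary.IsRepresentable) {f : E → ℝ}
    (hf : ContDiff ℝ ∞ f) (r : ℝ) (φ : TestForm Ω k) :
    Tendsto (fun n : ℕ => T.wedgeD (contDiff_sliceApprox hf r (1 / ((n : ℝ) + 1))) φ) atTop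
      (𝓝 (hT.slice hdT hf.continuous r φ)) := by
  simp_rw [Current.wedgeD_apply_eq, hT.slice_apply]
  refine Tendsto.sub ?_ ?_
  · exact hdT.tendsto_smulFun_apply (fun n => contDiff_sliceApprox hf r _)
      (fun n x => abs_sliceApprox_le f r _ x) _
      (Eventually.of_forall fun x => tendsto_sliceApprox f r x) φ
  · exact hT.tendsto_smulFun_apply (fun n => contDiff_sliceApprox hf r _)
      (fun n x => abs_sliceApprox_le f r _ x) _
      (Eventually.of_forall fun x => tendsto_sliceApprox f r x) (TestForm.extDerivCLM φ)

/-- The constant of the slicing inequality in dimension `k`: `(k + 1) · M_S`. [folklore] -/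
def sliceConst (k : ℕ) : ℝ := (k + 1) * smoothTransitionDerivBound

/-- `0 ≤ sliceConst k`. [folklore] -/
theorem sliceConst_nonneg (k : ℕ) : 0 ≤ sliceConst k :=
  mul_nonneg (by positivity) smoothTransitionDerivBound_nonneg

/-- **`|T(d g_{r,h} ∧ φ)| ≤ (C_k / h) ∫_{r ≤ f ≤ r+h} ‖Df‖ d‖T‖`** for `‖φ‖ ≤ 1` and representable `T`.
[cite: Federer1969, 4.2.1] -/
theorem Current.IsRepresentable.ofReal_wedgeD_sliceApprox_le {T : Current Ω (k + 1)}
    (hT : T.IsRepresentable) {f : E → ℝ} (hf : ContDiff ℝ ∞ f) (r : ℝ) {h : ℝ} (hh : 0 < h)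
    {φ : TestForm Ω k} (hφ : ∀ x, ‖φ x‖ ≤ 1) :
    ENNReal.ofReal (T.wedgeD (contDiff_sliceApprox hf r h) φ) ≤
      ENNReal.ofReal (sliceConst k / h) *
        ∫⁻ x in f ⁻¹' Icc r (r + h), ‖fderiv ℝ f x‖ₑ ∂T.variation := by
  rw [Current.wedgeD_apply]
  refine (hT.ofReal_apply_le_lintegral _).trans ?_
  have hmeas : MeasurableSet (f ⁻¹' Icc r (r + h)) := measurableSet_preimage hf.continuous.measurable
    measurableSet_Icc
  rw [← lintegral_indicator hmeas, ← lintegral_const_mul' _ _ ENNReal.ofReal_ne_top]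
  refine lintegral_mono fun x => ?_
  rw [← ofReal_norm]
  calc ENNReal.ofReal ‖TestForm.wedgeD (contDiff_sliceApprox hf r h) φ x‖
      ≤ ENNReal.ofReal (sliceConst k / h * ((f ⁻¹' Icc r (r + h)).indicator 1 x * ‖fderiv ℝ f x‖)) := by
        apply ENNReal.ofReal_le_ofReal
        refine (TestForm.norm_wedgeD_apply_le _ φ x).trans ?_
        calc ((k : ℝ) + 1) * ‖fderiv ℝ (sliceApprox f r h) x‖ * ‖φ x‖
            ≤ ((k : ℝ) + 1) * (smoothTransitionDerivBound / h * ‖fderiv ℝ f x‖ *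
                (f ⁻¹' Icc r (r + h)).indicator 1 x) * 1 :=
              mul_le_mul (mul_le_mul_of_nonneg_left (norm_fderiv_sliceApprox_le hf hh x)
                (by positivity)) (hφ x) (norm_nonneg _) (by
                  refine mul_nonneg (by positivity) (mul_nonneg (mul_nonneg (div_nonneg
                    smoothTransitionDerivBound_nonneg hh.le) (norm_nonneg _)) ?_)
                  exact indicator_nonneg (fun _ _ => zero_le_one) _)
          _ = sliceConst k / h * ((f ⁻¹' Icc r (r + h)).indicator 1 x * ‖fderiv ℝ f x‖) := by
              unfold sliceConst; ring
    _ = ENNReal.ofReal (sliceConst k / h) *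
          (f ⁻¹' Icc r (r + h)).indicator (fun x => ‖fderiv ℝ f x‖ₑ) x := by
        rw [ENNReal.ofReal_mul (div_nonneg (sliceConst_nonneg k) hh.le)]
        congr 1
        by_cases hx : x ∈ f ⁻¹' Icc r (r + h)
        · rw [indicator_of_mem hx, indicator_of_mem hx, Pi.one_apply, one_mul, ofReal_norm]
        · rw [indicator_of_notMem hx, indicator_of_notMem hx, zero_mul, ENNReal.ofReal_zero]

/-- The window terms of the slicing inequality:
`B n r = (C_k (n+1)) · ∫_{r ≤ f ≤ r + 1/(n+1)} ‖Df‖ d‖T‖`. [cite: Federer1969, 4.2.1] -/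
def sliceWindow (T : Current Ω (k + 1)) (f : E → ℝ) (n : ℕ) (r : ℝ) : ℝ≥0∞ :=
  ENNReal.ofReal (sliceConst k * ((n : ℝ) + 1)) *
    ∫⁻ x in f ⁻¹' Icc r (r + 1 / ((n : ℝ) + 1)), ‖fderiv ℝ f x‖ₑ ∂T.variation

/-- **`𝐌⟨T, f, r+⟩ ≤ liminfₙ C_k (n+1) ∫_{r ≤ f ≤ r + 1/(n+1)} ‖Df‖ d‖T‖`** — the pointwise
(in `r`) form of Federer's `𝐌⟨T, f, r+⟩ ≤ Lip(f) lim inf ‖T‖{r < f < r+h}/h`.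
[cite: Federer1969, 4.2.1] -/
theorem Current.IsRepresentable.mass_slice_le_liminf {T : Current Ω (k + 1)}
    (hT : T.IsRepresentable) (hdT : T.boundary.IsRepresentable) {f : E → ℝ}
    (hf : ContDiff ℝ ∞ f) (r : ℝ) :
    (hT.slice hdT hf.continuous r).mass ≤ liminf (fun n => sliceWindow T f n r) atTop := by
  refine iSup₂_le fun φ hφ => ?_
  have hlim := hT.tendsto_wedgeD_slice hdT hf r φ
  have hlim' : Tendsto (fun n : ℕ => ENNReal.ofReal
      (T.wedgeD (contDiff_sliceApprox hf r (1 / ((n : ℝ) + 1))) φ)) atTop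
      (𝓝 (ENNReal.ofReal (hT.slice hdT hf.continuous r φ))) :=
    (ENNReal.continuous_ofReal.tendsto _).comp hlim
  rw [← hlim'.liminf_eq]
  refine liminf_le_liminf (Eventually.of_forall fun n => ?_)
  have h := hT.ofReal_wedgeD_sliceApprox_le hf r (h := 1 / ((n : ℝ) + 1)) (by positivity) hφ
  refine h.trans (le_of_eq ?_)
  unfold sliceWindow
  congr 2
  field_simp

end SliceMass

/-! ### The integrated slicing inequality -/

section SliceIntegral

variable {E : Type*} [NormedAddCommGroup E] [NormedSpace ℝ E] [FiniteDimensional ℝ E]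
  [MeasurableSpace E] [BorelSpace E] {Ω : Opens E} {k : ℕ}

/-- `‖T‖` is σ-finite for a representable current (finite on an open exhaustion of `Ω`, zero off
`Ω`). [cite: Federer1969, 4.1.7] -/
theorem Current.IsRepresentable.sigmaFinite {m : ℕ} {T : Current Ω m} (hT : T.IsRepresentable) :
    SigmaFinite T.variation := by
  obtain ⟨O, hO, -, hcl, hclΩ, hUnion⟩ := exists_isOpen_exhaustion Ω
  refine (⟨fun n => O n ∪ (Ω : Set E)ᶜ, fun _ => mem_univ _, fun n => ?_, ?_⟩ :
    T.variation.FiniteSpanningSetsIn univ).sigmaFinite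
  · calc T.variation (O n ∪ (Ω : Set E)ᶜ) ≤ T.variation (O n) + T.variation (Ω : Set E)ᶜ :=
          measure_union_le _ _
      _ < ⊤ := by
          rw [Current.variation_compl, add_zero]
          exact (ne_top_of_le_ne_top (hT _ (hcl n) (hclΩ n)) (measure_mono subset_closure)).lt_top
  · rw [← iUnion_union, hUnion, union_compl_self]

/-- The window terms are measurable in the level `r` (Tonelli). [folklore] -/
theorem measurable_sliceWindow {T : Current Ω (k + 1)} (hT : T.IsRepresentable) {f : E → ℝ}
    (hf : ContDiff ℝ ∞ f) (n : ℕ) : Measurable (sliceWindow T f n) := by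
  haveI := hT.sigmaFinite
  have hS : MeasurableSet {p : ℝ × E | p.1 ≤ f p.2 ∧ f p.2 ≤ p.1 + 1 / ((n : ℝ) + 1)} :=
    (measurableSet_le measurable_fst (hf.continuous.measurable.comp measurable_snd)).inter
      (measurableSet_le (hf.continuous.measurable.comp measurable_snd)
        (measurable_fst.add measurable_const))
  have hmeas := measurable_measure_prodMk_left
    (ν := T.variation.withDensity fun x => ‖fderiv ℝ f x‖ₑ) hS
  have heq : sliceWindow T f n = fun r => ENNReal.ofReal (sliceConst k * ((n : ℝ) + 1)) *
      (T.variation.withDensity fun x => ‖fderiv ℝ f x‖ₑ)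
        (Prod.mk r ⁻¹' {p : ℝ × E | p.1 ≤ f p.2 ∧ f p.2 ≤ p.1 + 1 / ((n : ℝ) + 1)}) := by
    funext r
    unfold sliceWindow
    rw [show (Prod.mk r ⁻¹' {p : ℝ × E | p.1 ≤ f p.2 ∧ f p.2 ≤ p.1 + 1 / ((n : ℝ) + 1)}) =
        f ⁻¹' Icc r (r + 1 / ((n : ℝ) + 1)) from rfl,
      withDensity_apply _ (measurableSet_preimage hf.continuous.measurable measurableSet_Icc)]
  rw [heq]
  exact hmeas.const_mul _

/-- **The measurable majorant of the slice masses integrates to at most `C_k ∫ ‖Df‖ d‖T‖`**: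
`∫_{(a,b)} liminfₙ Bₙ(r) dr ≤ C_k ∫_{f⁻¹[a, b+ε]} ‖Df‖ d‖T‖` for every `ε > 0` (Fatou and Tonelli:
`∫_{(a,b)} Bₙ(r) dr ≤ C_k ν(f⁻¹[a, b + 1/(n+1)])`, `ν = ‖Df‖ ‖T‖`). [cite: Federer1969, 4.2.1] -/
theorem Current.IsRepresentable.lintegral_liminf_sliceWindow_le {T : Current Ω (k + 1)}
    (hT : T.IsRepresentable) {f : E → ℝ} (hf : ContDiff ℝ ∞ f) (a b : ℝ) {ε : ℝ} (hε : 0 < ε) :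
    ∫⁻ r in Ioo a b, liminf (fun n => sliceWindow T f n r) atTop ≤
      ENNReal.ofReal (sliceConst k) * ∫⁻ x in f ⁻¹' Icc a (b + ε), ‖fderiv ℝ f x‖ₑ ∂T.variation := by
  haveI := hT.sigmaFinite
  set ν : Measure E := T.variation.withDensity fun x => ‖fderiv ℝ f x‖ₑ with hν
  have hνapp : ∀ {s : Set E}, MeasurableSet s →
      ν s = ∫⁻ x in s, ‖fderiv ℝ f x‖ₑ ∂T.variation := fun hs => withDensity_apply _ hs
  have hfm : Measurable f := hf.continuous.measurable
  -- Step 1: Fatou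
  refine (lintegral_liminf_le fun n => measurable_sliceWindow hT hf n).trans ?_
  -- Step 2: Tonelli bound for each `n`
  have h2 : ∀ n : ℕ, ∫⁻ r in Ioo a b, sliceWindow T f n r ≤
      ENNReal.ofReal (sliceConst k) * ν (f ⁻¹' Icc a (b + 1 / ((n : ℝ) + 1))) := by
    intro n
    set h : ℝ := 1 / ((n : ℝ) + 1) with hh
    have hhpos : 0 < h := by positivity
    set S : Set (ℝ × E) := {p | p.1 ≤ f p.2 ∧ f p.2 ≤ p.1 + h} with hSdef
    have hS : MeasurableSet S :=
      (measurableSet_le measurable_fst (hfm.comp measurable_snd)).inter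
        (measurableSet_le (hfm.comp measurable_snd) (measurable_fst.add measurable_const))
    -- the window as a section of `S`
    have hwin : ∀ r, sliceWindow T f n r =
        ENNReal.ofReal (sliceConst k * ((n : ℝ) + 1)) * ∫⁻ x, S.indicator 1 (r, x) ∂ν := by
      intro r
      have hset : f ⁻¹' Icc r (r + 1 / ((n : ℝ) + 1)) = Prod.mk r ⁻¹' S := rfl
      unfold sliceWindow
      rw [← hνapp (measurableSet_preimage hfm measurableSet_Icc), hset,
        ← lintegral_indicator_one (measurable_prodMk_left hS)]
      rfl
    simp_rw [hwin]
    have hF : Measurable (S.indicator (1 : ℝ × E → ℝ≥0∞)) := measurable_one.indicator hS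
    have hinner : Measurable fun r => ∫⁻ x, S.indicator 1 (r, x) ∂ν :=
      hF.lintegral_prod_right'
    rw [lintegral_const_mul _ hinner,
      lintegral_lintegral_swap (μ := volume.restrict (Ioo a b)) (ν := ν)
        (f := fun r x => S.indicator (1 : ℝ × E → ℝ≥0∞) (r, x)) hF.aemeasurable]
    -- bound the inner integral in `r`
    have hIcc : MeasurableSet (f ⁻¹' Icc a (b + h)) := measurableSet_preimage hfm measurableSet_Icc
    have hbound : ∀ x, ∫⁻ r in Ioo a b, S.indicator 1 (r, x) ≤
        (f ⁻¹' Icc a (b + h)).indicator (fun _ => ENNReal.ofReal h) x := by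
      intro x
      by_cases hx : x ∈ f ⁻¹' Icc a (b + h)
      · rw [indicator_of_mem hx]
        calc ∫⁻ r in Ioo a b, S.indicator 1 (r, x)
            ≤ ∫⁻ r, S.indicator 1 (r, x) := setLIntegral_le_lintegral _ _
          _ ≤ ∫⁻ r, (Icc (f x - h) (f x)).indicator 1 r := lintegral_mono fun r => by
              by_cases hr : (r, x) ∈ S
              · have hmem : r ∈ Icc (f x - h) (f x) := by
                  obtain ⟨hr1, hr2⟩ := hr
                  change r ≤ f x at hr1
                  change f x ≤ r + h at hr2
                  exact ⟨by linarith, hr1⟩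
                rw [indicator_of_mem hr, indicator_of_mem hmem]
                exact le_rfl
              · rw [indicator_of_notMem hr]; exact bot_le
          _ = ENNReal.ofReal h := by
              rw [lintegral_indicator_one measurableSet_Icc, Real.volume_Icc]
              congr 1; ring
      · rw [indicator_of_notMem hx]
        apply le_of_eq
        apply setLIntegral_eq_zero measurableSet_Ioo
        intro r hr
        show S.indicator 1 (r, x) = 0
        rw [indicator_of_notMem]
        intro hrS
        apply hx
        obtain ⟨hr1, hr2⟩ := hrS
        change r ≤ f x at hr1
        change f x ≤ r + h at hr2
        exact ⟨by linarith [hr.1], by linarith [hr.2]⟩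
    calc ENNReal.ofReal (sliceConst k * ((n : ℝ) + 1)) *
          ∫⁻ x, (∫⁻ r in Ioo a b, S.indicator 1 (r, x)) ∂ν
        ≤ ENNReal.ofReal (sliceConst k * ((n : ℝ) + 1)) *
          ∫⁻ x, (f ⁻¹' Icc a (b + h)).indicator (fun _ => ENNReal.ofReal h) x ∂ν :=
          mul_le_mul' le_rfl (lintegral_mono hbound)
      _ = ENNReal.ofReal (sliceConst k * ((n : ℝ) + 1)) * (ENNReal.ofReal h *
          ν (f ⁻¹' Icc a (b + h))) := by rw [lintegral_indicator_const hIcc]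
      _ = ENNReal.ofReal (sliceConst k) * ν (f ⁻¹' Icc a (b + h)) := by
          rw [← mul_assoc, ← ENNReal.ofReal_mul (mul_nonneg (sliceConst_nonneg k) (by positivity))]
          congr 2
          rw [hh]; field_simp
  -- Step 3: `liminf` of the bounds
  refine (liminf_le_liminf (Eventually.of_forall h2)).trans ?_
  obtain ⟨N, hN⟩ := exists_nat_gt (1 / ε)
  refine liminf_le_of_frequently_le' (Eventually.frequently (eventually_atTop.2 ⟨N, fun n hn => ?_⟩))
  rw [hνapp (measurableSet_preimage hfm measurableSet_Icc)]
  refine mul_le_mul' le_rfl (lintegral_mono_set (preimage_mono (Icc_subset_Icc_right ?_)))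
  have hNpos : (0 : ℝ) < N := lt_trans (by positivity) hN
  have h1 : 1 / ((n : ℝ) + 1) ≤ 1 / (N : ℝ) :=
    one_div_le_one_div_of_le hNpos (by exact_mod_cast Nat.le_succ_of_le hn)
  have h2' : 1 / (N : ℝ) < ε := by
    rw [div_lt_iff₀ hNpos]
    rw [div_lt_iff₀ hε] at hN
    linarith
  linarith


/-- **The slicing inequality** [Federer1969, 4.2.1:
"`∫_a^{*b} 𝐌⟨T, f, r+⟩ dℒ¹ r ≤ Lip(f) ‖T‖{x : a < f(x) < b}`"], in the form: for every `ε > 0`,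
`∫_{(a,b)} 𝐌⟨T, f, r+⟩ dr ≤ C_k ∫_{f⁻¹[a, b+ε]} ‖Df‖ d‖T‖` (lower Lebesgue integral in `r`), with
`C_k = (k+1) · sup |S'|` the constant of the smooth transition used to approximate `1_{f > r}`
(Federer's sharp constant `Lip f` w.r.t. the comass norm becomes the operator-norm bookkeeping;
the right windows `[r, r+h]` account for the `ε`). From `mass_slice_le_liminf` and
`lintegral_liminf_sliceWindow_le`. [cite: Federer1969, 4.2.1] -/
theorem Current.IsRepresentable.lintegral_mass_slice_le {T : Current Ω (k + 1)}
    (hT : T.IsRepresentable) (hdT : T.boundary.IsRepresentable) {f : E → ℝ}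
    (hf : ContDiff ℝ ∞ f) (a b : ℝ) {ε : ℝ} (hε : 0 < ε) :
    ∫⁻ r in Ioo a b, (hT.slice hdT hf.continuous r).mass ≤
      ENNReal.ofReal (sliceConst k) * ∫⁻ x in f ⁻¹' Icc a (b + ε), ‖fderiv ℝ f x‖ₑ ∂T.variation :=
  (lintegral_mono fun r => hT.mass_slice_le_liminf hdT hf r).trans
    (hT.lintegral_liminf_sliceWindow_le hf a b hε)

/-- **Almost every slice has finite mass** when `‖Df‖` is bounded and `𝐌(T) < ∞`
(`T`, `∂T` representable): `𝐌⟨T, f, r+⟩ < ∞` for `ℒ¹`-a.e. `r` [Federer1969, 4.2.1: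
"`⟨T, f, r+⟩ ∈ 𝒟_{m-1}(U)` … for `ℒ¹` almost all `r`" the slice is normal]. The measurable majorant
`liminfₙ Bₙ` is a.e. finite on every bounded interval. [cite: Federer1969, 4.2.1] -/
theorem Current.IsRepresentable.ae_mass_slice_lt_top {T : Current Ω (k + 1)}
    (hT : T.IsRepresentable) (hdT : T.boundary.IsRepresentable) {f : E → ℝ}
    (hf : ContDiff ℝ ∞ f) {L : ℝ} (hL : ∀ x, ‖fderiv ℝ f x‖ ≤ L) (hmass : T.mass ≠ ⊤) :
    ∀ᵐ r ∂(volume : Measure ℝ), (hT.slice hdT hf.continuous r).mass < ⊤ := by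
  have hL0 : 0 ≤ L := (norm_nonneg _).trans (hL 0)
  -- the majorant is a.e. finite on `(-N, N)` for every `N`
  have hfin : ∀ N : ℕ, ∀ᵐ r ∂(volume : Measure ℝ), r ∈ Ioo (-(N : ℝ)) N →
      liminf (fun n => sliceWindow T f n r) atTop < ⊤ := by
    intro N
    have hI := hT.lintegral_liminf_sliceWindow_le hf (-(N : ℝ)) N one_pos
    have hRHS : ENNReal.ofReal (sliceConst k) *
        ∫⁻ x in f ⁻¹' Icc (-(N : ℝ)) (N + 1), ‖fderiv ℝ f x‖ₑ ∂T.variation ≠ ⊤ := by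
      refine ENNReal.mul_ne_top ENNReal.ofReal_ne_top (ne_top_of_le_ne_top
        (ENNReal.mul_ne_top (ENNReal.ofReal_ne_top (r := L)) hmass) ?_)
      calc ∫⁻ x in f ⁻¹' Icc (-(N : ℝ)) (N + 1), ‖fderiv ℝ f x‖ₑ ∂T.variation
          ≤ ∫⁻ _ in f ⁻¹' Icc (-(N : ℝ)) (N + 1), ENNReal.ofReal L ∂T.variation :=
            lintegral_mono fun x => by rw [← ofReal_norm]; exact ENNReal.ofReal_le_ofReal (hL x)
        _ ≤ ENNReal.ofReal L * T.mass := by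
            rw [setLIntegral_const]
            exact mul_le_mul' le_rfl (T.variation_le_mass _)
    have hmeas : Measurable fun r => liminf (fun n => sliceWindow T f n r) atTop :=
      Measurable.liminf fun n => measurable_sliceWindow hT hf n
    have := ae_lt_top' hmeas.aemeasurable (ne_top_of_le_ne_top hRHS hI)
    exact (ae_restrict_iff' measurableSet_Ioo).1 this
  rw [← ae_all_iff] at hfin
  filter_upwards [hfin] with r hr
  obtain ⟨N, hN⟩ := exists_nat_gt |r|
  have hrN : r ∈ Ioo (-(N : ℝ)) N := ⟨by linarith [neg_abs_le r], lt_of_le_of_lt (le_abs_self r) hN⟩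
  exact (hT.mass_slice_le_liminf hdT hf r).trans_lt (hr N hrN)

/-- **Almost every slice of a normal current is normal**: for `T ∈ 𝒟_{k+2}` with `T`, `∂T`
representable of finite mass and `‖Df‖` bounded, `𝐍⟨T, f, r+⟩ = 𝐌⟨T, f, r+⟩ + 𝐌⟨∂T, f, r+⟩ < ∞` for
a.e. `r` (`∂⟨T, f, r+⟩ = −⟨∂T, f, r+⟩`). [cite: Federer1969, 4.2.1] -/
theorem Current.IsRepresentable.ae_normalMass_slice_lt_top {T : Current Ω (k + 2)}
    (hT : T.IsRepresentable) (hdT : T.boundary.IsRepresentable) {f : E → ℝ}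
    (hf : ContDiff ℝ ∞ f) {L : ℝ} (hL : ∀ x, ‖fderiv ℝ f x‖ ≤ L) (hmass : T.mass ≠ ⊤)
    (hbmass : T.boundary.mass ≠ ⊤) :
    ∀ᵐ r ∂(volume : Measure ℝ), (hT.slice hdT hf.continuous r).normalMass < ⊤ := by
  have hddT : T.boundary.boundary.IsRepresentable := by
    rw [Current.boundary_boundary]; exact Current.isRepresentable_zero
  filter_upwards [hT.ae_mass_slice_lt_top hdT hf hL hmass,
    hdT.ae_mass_slice_lt_top hddT hf hL hbmass] with r h1 h2
  unfold Current.normalMass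
  rw [hT.boundary_slice hdT hddT hf.continuous r, Current.mass_neg]
  exact ENNReal.add_lt_top.2 ⟨h1, h2⟩

end SliceIntegral

end Literature.Geometry.GeometricMeasureTheory
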